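import Mathlib
import Literature.Analysis.FluidPDE.Tao2016AveragedNS.GlobalWellposedness
import Literature.Analysis.FluidPDE.Tao2016AveragedNS.SelfSimilarCascadeResidues
import Summits.NavierStokesRegularity.NavierStokesRegularity.Theorems.TaoLadderRungTwoBreakBlowupRigidityOneFiniteTimeBlowup
import HarnessLib

/-!
# Void tables for K2(1): without a live outflow constant there is neither robust blow-up nor an
  admissible DSS wave — both sides of `TaoLadderRungTwoBreak.BlowupRigidityOne`
  (stmt-NavierStokesRegularity-20206) live on tables with `fluxConst α ≥ 1/R`

MODEL lattice ODEs only (Tao 2016 §4 (4.1)–(4.3), (4.8); §5 (ode)–(g-cancel)); nothing here is a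
statement about the Navier–Stokes equations; NO item is closed (`--supports
stmt-NavierStokesRegularity-20206`). General `m`; DEF-FREE (the outflow-free hypothesis is spelled
`∀ i₁ i₂ i, α i₁ i₂ i (0,0,1) = 0`, i.e. `tableA α = 0`).

K2(1) reads `∀ R ≥ 1 ∃ εs ∀ ε₀ ∈ (0,εs] ∀ α ∈ E₂(R) ∀ X₀, NoGlobalCascade ε₀ α X₀ → ∃` a non-trivial
(S₁)-surviving admissible DSS wave of `α`. This file calibrates the statement on the degenerate corner of
the comparable class `E₂(R)` (which `IsComparableCoeff` admits: zero entries are allowed):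

* `quadTerm_oneShell_of_outflow_zero`, `isCancelling_intraField`, `contDiff_intraField`,
  `exists_regularExactFlow_of_outflow_zero` — if every structure constant at the outflow shift `(0,0,1)`
  vanishes, a family supported on ONE shell feels only the intra-shell quadratic field, a cancelling
  smooth field (Tao §5) with a global trajectory (`IsCancelling.exists_solution`, tree): the one-shell
  datum generates a GLOBAL exact (4.5)-regular lattice flow living on shell `0` for ever;
* `not_noGlobalCascade_of_outflow_zero` — hence NO robust blow-up on an outflow-free table of `E₂(R)`,
  for every `ε₀ > 0` and every datum (via the landed `noRegularExactFlow_of_noGlobalCascade`);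
* `norm_sq_profile_of_outflow_zero`, `dssWave_trivial_of_outflow_zero` — every profile of an
  admissible DSS wave of an outflow-free cancelling table has `‖Φ_r(x)‖² = ‖Φ_r(0)‖² e^{-2x}` (feed and
  drain do no work), and the integrable-mass clause forces `Φ ≡ 0`: NO non-trivial admissible DSS
  wave, at ANY scale ratio and delay;
* `exists_outflow_ge_of_noGlobalCascade`, `exists_outflow_ge_of_dssWave_nontrivial`,
  `fluxConst_ge_of_noGlobalCascade`, `fluxConst_ge_of_dssWave_nontrivial` — NUMBERS: on `E₂(R)` both
  the hypothesis and the conclusion of K2(1) force some `|α_{i₁i₂i,(0,0,1)}| ≥ R⁻¹`, so `fluxConst α ≥ R⁻¹`;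
* `blowupRigidityOne_on_outflow_zero` — the K2(1) implication holds (vacuously) on the outflow-free
  corner of every `E₂(R)`, uniformly in `ε₀ > 0`: the crux has content only on tables with a live
  forward coupling of size `≥ 1/R`.

HONEST LABEL: calibration of one aside leaf on a degenerate sub-class; no stub, crux or summit is
proved; rung 0.
-/

noncomputable section

-- the summit and its single sub-problem share the name (CONVENTIONS §1)
set_option linter.dupNamespace false

open Set Filter Topology MeasureTheory
open scoped RealInnerProductSpace

namespace Summit.NavierStokesRegularity.NavierStokesRegularity.Theorems

namespace BlowupRigidityOne

open Literature.Analysis.FluidPDE Literature.Analysis.FluidPDE.TaoCascade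
  Literature.Analysis.FluidPDE.Tao2016AveragedNS

variable {m : ℕ}

/-! ## The one-shell flow of an outflow-free table -/

/-- **Outflow-free tables do not couple a lone shell to its neighbours.** If every structure constant
at the outflow shift `(0,0,1)` vanishes, then for a family supported on shell `0`,
`X_{j,n}(s) = y(s)_j 1_{n=0}`, the cascade nonlinearity (4.8) is the intra-shell quadratic field
`(Σ_{i₁i₂} α_{i₁i₂i,(0,0,0)} y_{i₁} y_{i₂})_i` on shell `0` and `0` on every other shell.
[cite: Tao2016AveragedNS, §4 (4.1) and Lemma 4.1 (4.8)] -/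
theorem quadTerm_oneShell_of_outflow_zero {ε₀ : ℝ}
    {α : Fin m → Fin m → Fin m → ℤ × ℤ × ℤ → ℝ}
    (hA : ∀ i₁ i₂ i, α i₁ i₂ i ((0 : ℤ), (0 : ℤ), (1 : ℤ)) = 0)
    (y : ℝ → Fin m → ℝ) (i : Fin m) (k : ℤ) (t : ℝ) :
    quadTerm ε₀ α (fun j n s => if n = 0 then y s j else 0) i k t =
      if k = 0 then ∑ i₁, ∑ i₂, α i₁ i₂ i (0, 0, 0) * (y t i₁ * y t i₂) else 0 := by
  unfold quadTerm
  by_cases hk : k = 0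
  · subst hk
    rw [if_pos rfl]
    refine Finset.sum_congr rfl fun i₁ _ => Finset.sum_congr rfl fun i₂ _ => ?_
    have h000 : ((0 : ℤ), (0 : ℤ), (0 : ℤ)) ∈ shiftSet := by simp [shiftSet]
    rw [Finset.sum_eq_single_of_mem _ h000]
    · simp
    · intro μ hμ hne
      rcases (mem_shiftSet_iff μ).1 hμ with rfl | rfl | rfl | rfl
      · exact absurd rfl hne
      · simp
      · simp
      · simp [hA]
  · rw [if_neg hk]
    refine Finset.sum_eq_zero fun i₁ _ => Finset.sum_eq_zero fun i₂ _ =>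
      Finset.sum_eq_zero fun μ hμ => ?_
    rcases (mem_shiftSet_iff μ).1 hμ with rfl | rfl | rfl | rfl
    · simp [hk]
    · simp [hk]
    · simp [hk]
    · simp [hA]

/-- **The intra-shell field of a cancelling table is cancelling** (Tao §5 (g-cancel)): by (4.3) at
`μ = (0,0,0)` the cubic form `Σ α_{abc,(0,0,0)} y_a y_b y_c` vanishes.
[cite: Tao2016AveragedNS, §4 (4.3) and §5 (g-cancel)] -/
theorem isCancelling_intraField {α : Fin m → Fin m → Fin m → ℤ × ℤ × ℤ → ℝ}
    (hc : IsCancellingCoeff α) :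
    IsCancelling (fun (y : Fin m → ℝ) (i : Fin m) => ∑ i₁, ∑ i₂, α i₁ i₂ i (0, 0, 0) * (y i₁ * y i₂)) := by
  intro y
  have step : (∑ i, (∑ i₁, ∑ i₂, α i₁ i₂ i (0, 0, 0) * (y i₁ * y i₂)) * y i)
      = ∑ a, ∑ b, ∑ c, α a b c (0, 0, 0) * (y a * y b * y c) := by
    rw [← sum3_rotate]
    refine Finset.sum_congr rfl fun c _ => ?_
    rw [Finset.sum_mul]
    refine Finset.sum_congr rfl fun a _ => ?_
    rw [Finset.sum_mul]
    exact Finset.sum_congr rfl fun b _ => by ring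
  rw [step]
  have h000 : ((0 : ℤ), (0 : ℤ), (0 : ℤ)) ∈ shiftSet := by simp [shiftSet]
  exact cubic_sum_eq_zero (fun a b c => α a b c (0, 0, 0)) (fun a b c => y a * y b * y c)
    (fun a b c => by ring) (fun a b c => by ring) (fun a b c => hc a b c 0 0 0 h000)

/-- The intra-shell field is a polynomial, hence smooth, vector field on `ℝ^m`. [folklore] -/
theorem contDiff_intraField (α : Fin m → Fin m → Fin m → ℤ × ℤ × ℤ → ℝ) {n : WithTop ℕ∞} :
    ContDiff ℝ n (fun (y : Fin m → ℝ) (i : Fin m) => ∑ i₁, ∑ i₂, α i₁ i₂ i (0, 0, 0) * (y i₁ * y i₂)) := by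
  refine contDiff_pi.2 fun i => ?_
  fun_prop

/-- **A lone shell of an outflow-free cancelling table flows globally.** For every horizon `T` the
one-shell datum `X₀` at shell `0` generates an EXACT lattice flow on `[0,T]` (datum, the law (4.8) with no
defect as a one-sided derivative within `[0,T]`, and the a priori bound (4.5)) — namely the global
trajectory of the cancelling intra-shell field on shell `0` (energy `Σ y_i²` conserved) and `0` elsewhere.
[cite: Tao2016AveragedNS, §4 Lemma 4.1 (4.5), (4.7), (4.8) and §5 p. 25 (cancelling circuits are globally well posed)] -/
theorem exists_regularExactFlow_of_outflow_zero {ε₀ : ℝ}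
    {α : Fin m → Fin m → Fin m → ℤ × ℤ × ℤ → ℝ} (hc : IsCancellingCoeff α)
    (hA : ∀ i₁ i₂ i, α i₁ i₂ i ((0 : ℤ), (0 : ℤ), (1 : ℤ)) = 0) (X₀ : Fin m → ℝ) (T : ℝ) :
    ∃ X : Fin m → ℤ → ℝ → ℝ,
      (∀ i k, X i k 0 = if k = 0 then X₀ i else 0) ∧
      (∀ i k, ∀ t ∈ Icc 0 T, HasDerivWithinAt (X i k) (quadTerm ε₀ α X i k t) (Icc 0 T) t) ∧
      ∃ M : ℝ, ∀ t ∈ Icc 0 T, ∀ (i : Fin m) (k : ℤ),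
        (1 + (1 + ε₀) ^ ((10 : ℝ) * k)) * |X i k t| ≤ M := by
  obtain ⟨y, hy0, hy⟩ :=
    (isCancelling_intraField hc).exists_solution (contDiff_intraField α) X₀
  refine ⟨fun j n s => if n = 0 then y s j else 0, fun i k => ?_, fun i k t _ => ?_,
    ⟨2 * Real.sqrt (energy X₀), fun t _ i k => ?_⟩⟩
  · by_cases hk : k = 0
    · simp [hk, hy0]
    · simp [hk]
  · rw [quadTerm_oneShell_of_outflow_zero hA]
    by_cases hk : k = 0
    · subst hk
      simp only [if_true]
      exact ((hasDerivAt_pi.1 (hy t)) i).hasDerivWithinAt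
    · simp only [hk, if_false]
      exact hasDerivWithinAt_const _ _ _
  · by_cases hk : k = 0
    · subst hk
      have hw : (1 + (1 + ε₀) ^ ((10 : ℝ) * ((0 : ℤ) : ℝ))) = 2 := by norm_num
      simp only [if_true]
      rw [hw]
      have he : energy (y t) = energy X₀ := by
        rw [← hy0]; exact (energy_eq_of_isCancelling (isCancelling_intraField hc) hy 0 t).symm
      have := abs_apply_le_sqrt_energy (y t) i
      rw [he] at this
      linarith
    · simp only [hk, if_false, abs_zero, mul_zero]
      positivity

/-- **NO ROBUST BLOW-UP ON AN OUTFLOW-FREE TABLE.** If `α ∈ E₂(R)` has every structure constant at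
the outflow shift `(0,0,1)` equal to `0`, then `NoGlobalCascade ε₀ α X₀` FAILS for every `ε₀ > 0` and every
one-shell datum `X₀`: robust blow-up would forbid a (4.5)-regular exact flow on some `[0,T]`
(`noRegularExactFlow_of_noGlobalCascade`), but the lone-shell flow is one.
[cite: Tao2016AveragedNS, §4 Thm. 4.2 (statement shape), Lemma 4.1 (4.5)–(4.8), §5 p. 25; cell vocabulary (`NoGlobalCascade`)] -/
theorem not_noGlobalCascade_of_outflow_zero {ε₀ R : ℝ}
    {α : Fin m → Fin m → Fin m → ℤ × ℤ × ℤ → ℝ} {X₀ : Fin m → ℝ}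
    (hε : 0 < ε₀) (hα : InTableClass R α)
    (hA : ∀ i₁ i₂ i, α i₁ i₂ i ((0 : ℤ), (0 : ℤ), (1 : ℤ)) = 0) :
    ¬ NoGlobalCascade ε₀ α X₀ := by
  intro hNG
  obtain ⟨T, _, hno⟩ := noRegularExactFlow_of_noGlobalCascade hε hα hNG
  exact hno (exists_regularExactFlow_of_outflow_zero hα.2.1 hA X₀ T)

/-! ## The wave side: no admissible DSS wave on an outflow-free table -/

/-- On an outflow-free table the outflow map vanishes: `tableA α = 0`.
[cite: Tao2016AveragedNS, §4 (4.1), Lemma 4.1 (4.8); cell vocabulary (`tableA`)] -/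
theorem tableA_eq_zero_of_outflow_zero {α : Fin m → Fin m → Fin m → ℤ × ℤ × ℤ → ℝ}
    (hA : ∀ i₁ i₂ i, α i₁ i₂ i ((0 : ℤ), (0 : ℤ), (1 : ℤ)) = 0) (x : Em m) : tableA α x = 0 := by
  unfold tableA qform
  simp [hA]

/-- **Feed and drain do no work on an outflow-free cancelling table**: every profile of a solution of
the renormalised profile system (`IsSWave` with damping `1`, any feed/drain coefficients built from
`tableA α = 0` and `tableB α`) has `‖Φ_r(x)‖² = ‖Φ_r(0)‖² e^{-2x}` — intra-shell neutrality
`⟪x, Q x⟫ = 0` and the type-split cancellation `⟪x, B(y,x)⟫ = -⟪y, A x⟫ = 0` (`table_sTable`).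
[cite: Tao2016AveragedNS, §4 (4.3) and Lemma 4.1 (iii) (4.8) in self-similar variables; cell vocabulary (`IsDSSWave`)] -/
theorem norm_sq_profile_of_outflow_zero {ε₀ : ℝ} {α : Fin m → Fin m → Fin m → ℤ × ℤ × ℤ → ℝ}
    (hc : IsCancellingCoeff α) (hA : ∀ i₁ i₂ i, α i₁ i₂ i ((0 : ℤ), (0 : ℤ), (1 : ℤ)) = 0)
    {ρ : Type*} [Fintype ρ] {π : Equiv.Perm ρ} {T : ℝ} {Φ : ρ → ℝ → Em m}
    (hW : IsDSSWave ε₀ α π T Φ) (r : ρ) (x : ℝ) :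
    ‖Φ r x‖ ^ 2 = ‖Φ r 0‖ ^ 2 * Real.exp (-(2 * x)) := by
  have hST := table_sTable α hc
  -- the energy of the profile solves `f' = -2 f`
  have hder : ∀ z, HasDerivAt (fun z => ‖Φ r z‖ ^ 2) (-(2 * ‖Φ r z‖ ^ 2)) z := by
    intro z
    have h := (hW.wave r z).norm_sq
    have hin : ⟪Φ r z, -((1 : ℝ) • Φ r z) + tableQ α (Φ r z)
        + bigLam ε₀ • tableA α (Φ (π.symm r) (z + T))
        + (bigLam ε₀)⁻¹ • tableB α (Φ (π r) (z - T)) (Φ r z)⟫ = -‖Φ r z‖ ^ 2 := by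
      rw [inner_add_right, inner_add_right, inner_add_right, inner_neg_right, inner_smul_right,
        inner_smul_right, inner_smul_right, real_inner_self_eq_norm_sq, hST.intra,
        tableA_eq_zero_of_outflow_zero hA, inner_zero_right]
      have hB : ⟪Φ r z, tableB α (Φ (π r) (z - T)) (Φ r z)⟫ = 0 := by
        have h2 := hST.cancel (Φ r z) (Φ (π r) (z - T))
        rw [tableA_eq_zero_of_outflow_zero hA, inner_zero_right, zero_add] at h2
        exact h2
      rw [hB]
      ring
    rw [hin] at h
    convert h using 1
    ring
  -- hence `e^{2z} f(z)` is constant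
  have hconst : ∀ z, Real.exp (2 * z) * ‖Φ r z‖ ^ 2 = ‖Φ r 0‖ ^ 2 := by
    intro z
    have hd : ∀ w, HasDerivAt (fun w => Real.exp (2 * w) * ‖Φ r w‖ ^ 2) 0 w := by
      intro w
      have he : HasDerivAt (fun w => Real.exp (2 * w)) (Real.exp (2 * w) * 2) w := by
        have := (hasDerivAt_id w).const_mul (2 : ℝ)
        simp only [mul_one] at this
        exact (Real.hasDerivAt_exp (2 * w)).comp w this
      have h1 := he.mul (hder w)
      have e : Real.exp (2 * w) * 2 * ‖Φ r w‖ ^ 2 + Real.exp (2 * w) * (-(2 * ‖Φ r w‖ ^ 2)) = 0 := by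
        ring
      rw [e] at h1
      exact h1
    have h := is_const_of_deriv_eq_zero (f := fun w => Real.exp (2 * w) * ‖Φ r w‖ ^ 2)
      (fun w => (hd w).differentiableAt) (fun w => (hd w).deriv) z 0
    simpa using h
  have h := hconst x
  have hexp : Real.exp (2 * x) * Real.exp (-(2 * x)) = 1 := by
    rw [← Real.exp_add, add_neg_cancel, Real.exp_zero]
  calc ‖Φ r x‖ ^ 2 = Real.exp (2 * x) * ‖Φ r x‖ ^ 2 * Real.exp (-(2 * x)) := by
        rw [mul_comm (Real.exp (2 * x)), mul_assoc, hexp, mul_one]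
    _ = ‖Φ r 0‖ ^ 2 * Real.exp (-(2 * x)) := by rw [h]

/-- The function `x ↦ e^{-x}` is not integrable on `ℝ` (it dominates `1` on `(-∞,0]`, a set of infinite
Lebesgue measure). [folklore] -/
theorem not_integrable_exp_neg : ¬ Integrable (fun x : ℝ => Real.exp (-x)) := by
  intro h
  have h1 : IntegrableOn (fun _ : ℝ => (1 : ℝ)) (Iic (0 : ℝ)) := by
    refine (h.integrableOn (s := Iic 0)).mono' aestronglyMeasurable_const ?_
    refine (ae_restrict_mem measurableSet_Iic).mono fun x hx => ?_
    rw [norm_one]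
    have : Real.exp 0 ≤ Real.exp (-x) := Real.exp_le_exp.2 (by simpa using hx)
    simpa using this
  have h2 : volume (Iic (0 : ℝ)) < ⊤ := by
    have := (integrableOn_const_iff (C := (1 : ℝ)) (s := Iic (0 : ℝ)) (μ := volume)).1 h1
    exact this.resolve_left (by simp)
  simp at h2

/-- **NO ADMISSIBLE DSS WAVE ON AN OUTFLOW-FREE TABLE.** If `α` is cancelling with every structure
constant at `(0,0,1)` equal to `0`, then every admissible DSS wave of `α` (`IsDSSWave ε₀ α π T Φ`, ANY
scale ratio `ε₀`, any delay, any finite profile family) is trivial: by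
`norm_sq_profile_of_outflow_zero` each profile has mass `‖Φ_r(x)‖ = ‖Φ_r(0)‖ e^{-x}`, which the
integrable-summed-mass clause `mass` excludes unless `Φ_r(0) = 0`.
[cite: Tao2016AveragedNS, §4 (4.3), Lemma 4.1 (iii) (4.8); cell vocabulary (`IsDSSWave`, clause `mass`)] -/
theorem dssWave_trivial_of_outflow_zero {ε₀ : ℝ} {α : Fin m → Fin m → Fin m → ℤ × ℤ × ℤ → ℝ}
    (hc : IsCancellingCoeff α) (hA : ∀ i₁ i₂ i, α i₁ i₂ i ((0 : ℤ), (0 : ℤ), (1 : ℤ)) = 0)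
    {ρ : Type*} [Fintype ρ] {π : Equiv.Perm ρ} {T : ℝ} {Φ : ρ → ℝ → Em m}
    (hW : IsDSSWave ε₀ α π T Φ) : ∀ r x, Φ r x = 0 := by
  intro r
  -- Step 1: `‖Φ_r(0)‖ = 0`, else `e^{-x}` would be integrable
  have h0 : ‖Φ r 0‖ = 0 := by
    by_contra hne
    have hpos : 0 < ‖Φ r 0‖ := lt_of_le_of_ne (norm_nonneg _) (Ne.symm hne)
    -- `‖Φ_r‖` is integrable, dominated by the summed mass
    have hcont : Continuous fun x => ‖Φ r x‖ :=
      (continuous_iff_continuousAt.2 fun x => (hW.wave r x).continuousAt).norm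
    have hint : Integrable (fun x => ‖Φ r x‖) := by
      refine hW.mass.mono' hcont.aestronglyMeasurable (Eventually.of_forall fun x => ?_)
      rw [norm_norm]
      exact Finset.single_le_sum (f := fun r' => ‖Φ r' x‖) (fun r' _ => norm_nonneg _)
        (Finset.mem_univ r)
    -- and `‖Φ_r(x)‖ = ‖Φ_r(0)‖ e^{-x}`
    have heq : (fun x => ‖Φ r x‖) = fun x => ‖Φ r 0‖ * Real.exp (-x) := by
      funext x
      have hsq := norm_sq_profile_of_outflow_zero hc hA hW r x
      have hrhs : ‖Φ r 0‖ ^ 2 * Real.exp (-(2 * x)) = (‖Φ r 0‖ * Real.exp (-x)) ^ 2 := by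
        have h2 : Real.exp (-(2 * x)) = Real.exp (-x) ^ 2 := by
          rw [sq, ← Real.exp_add]
          exact congrArg Real.exp (by ring)
        rw [h2, mul_pow]
      rw [hrhs] at hsq
      exact (pow_left_inj₀ (norm_nonneg _) (by positivity) two_ne_zero).1 hsq
    rw [heq] at hint
    have hexp : Integrable (fun x : ℝ => Real.exp (-x)) := by
      have := hint.const_mul (‖Φ r 0‖⁻¹)
      refine this.congr (Eventually.of_forall fun x => ?_)
      simp only
      rw [← mul_assoc, inv_mul_cancel₀ hne, one_mul]
    exact not_integrable_exp_neg hexp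
  -- Step 2: the energy identity propagates `Φ_r(0) = 0` to every `x`
  intro x
  have hsq := norm_sq_profile_of_outflow_zero hc hA hW r x
  rw [h0] at hsq
  simp only [ne_eq, OfNat.ofNat_ne_zero, not_false_eq_true, zero_pow, zero_mul] at hsq
  exact norm_eq_zero.1 (pow_eq_zero_iff two_ne_zero |>.1 hsq)

/-! ## Numbers: both sides of K2(1) force a live outflow constant `≥ 1/R` -/

/-- **Robust blow-up forces a live outflow constant.** If `α ∈ E₂(R)` and `NoGlobalCascade ε₀ α X₀`
(`ε₀ > 0`), then some structure constant at the outflow shift satisfies `R⁻¹ ≤ |α_{i₁i₂i,(0,0,1)}|`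
(contrapositive of `not_noGlobalCascade_of_outflow_zero`, with the comparability dichotomy of `E₂(R)`:
a non-zero constant has modulus `≥ R⁻¹`).
[cite: Tao2016AveragedNS, §4 Thm. 4.2 (statement shape), §6.1 (comparable tables); cell vocabulary (`InTableClass`, `NoGlobalCascade`)] -/
theorem exists_outflow_ge_of_noGlobalCascade {ε₀ R : ℝ}
    {α : Fin m → Fin m → Fin m → ℤ × ℤ × ℤ → ℝ} {X₀ : Fin m → ℝ}
    (hε : 0 < ε₀) (hα : InTableClass R α) (hNG : NoGlobalCascade ε₀ α X₀) :
    ∃ i₁ i₂ i, R⁻¹ ≤ |α i₁ i₂ i ((0 : ℤ), (0 : ℤ), (1 : ℤ))| := by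
  by_contra h
  push Not at h
  have hA : ∀ i₁ i₂ i, α i₁ i₂ i ((0 : ℤ), (0 : ℤ), (1 : ℤ)) = 0 := by
    intro i₁ i₂ i
    have h001 : ((0 : ℤ), (0 : ℤ), (1 : ℤ)) ∈ shiftSet := by simp [shiftSet]
    rcases (hα.2.2 i₁ i₂ i _ h001).2 with hz | hge
    · exact hz
    · exact absurd hge (not_le.2 (h i₁ i₂ i))
  exact not_noGlobalCascade_of_outflow_zero hε hα hA hNG

/-- Hence **robust blow-up on `E₂(R)` forces `fluxConst α ≥ R⁻¹`**.
[cite: Tao2016AveragedNS, §4 (4.1), Thm. 4.2 (statement shape); cell vocabulary (`fluxConst`)] -/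
theorem fluxConst_ge_of_noGlobalCascade {ε₀ R : ℝ}
    {α : Fin m → Fin m → Fin m → ℤ × ℤ × ℤ → ℝ} {X₀ : Fin m → ℝ}
    (hε : 0 < ε₀) (hα : InTableClass R α) (hNG : NoGlobalCascade ε₀ α X₀) :
    R⁻¹ ≤ fluxConst α := by
  obtain ⟨i₁, i₂, i, h⟩ := exists_outflow_ge_of_noGlobalCascade hε hα hNG
  refine h.trans ?_
  unfold fluxConst
  refine le_trans ?_ (Finset.single_le_sum (f := fun i => ∑ i₁, ∑ i₂, |α i₁ i₂ i (0, 0, 1)|)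
    (fun j _ => Finset.sum_nonneg fun _ _ => Finset.sum_nonneg fun _ _ => abs_nonneg _)
    (Finset.mem_univ i))
  refine le_trans ?_ (Finset.single_le_sum (f := fun i₁ => ∑ i₂, |α i₁ i₂ i (0, 0, 1)|)
    (fun j _ => Finset.sum_nonneg fun _ _ => abs_nonneg _) (Finset.mem_univ i₁))
  exact Finset.single_le_sum (f := fun i₂ => |α i₁ i₂ i (0, 0, 1)|) (fun j _ => abs_nonneg _)
    (Finset.mem_univ i₂)

/-- **A non-trivial admissible DSS wave forces a live outflow constant.** If `α ∈ E₂(R)` carries an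
admissible DSS wave with `Φ r x ≠ 0` for some `r, x`, then some `|α_{i₁i₂i,(0,0,1)}| ≥ R⁻¹`.
[cite: Tao2016AveragedNS, §4 (4.3), Lemma 4.1 (iii) (4.8), §6.1; cell vocabulary (`IsDSSWave`, `InTableClass`)] -/
theorem exists_outflow_ge_of_dssWave_nontrivial {ε₀ R : ℝ}
    {α : Fin m → Fin m → Fin m → ℤ × ℤ × ℤ → ℝ} (hα : InTableClass R α)
    {ρ : Type*} [Fintype ρ] {π : Equiv.Perm ρ} {T : ℝ} {Φ : ρ → ℝ → Em m}
    (hW : IsDSSWave ε₀ α π T Φ) (hnt : ∃ r x, Φ r x ≠ 0) :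
    ∃ i₁ i₂ i, R⁻¹ ≤ |α i₁ i₂ i ((0 : ℤ), (0 : ℤ), (1 : ℤ))| := by
  by_contra h
  push Not at h
  have hA : ∀ i₁ i₂ i, α i₁ i₂ i ((0 : ℤ), (0 : ℤ), (1 : ℤ)) = 0 := by
    intro i₁ i₂ i
    have h001 : ((0 : ℤ), (0 : ℤ), (1 : ℤ)) ∈ shiftSet := by simp [shiftSet]
    rcases (hα.2.2 i₁ i₂ i _ h001).2 with hz | hge
    · exact hz
    · exact absurd hge (not_le.2 (h i₁ i₂ i))
  obtain ⟨r, x, hrx⟩ := hnt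
  exact hrx (dssWave_trivial_of_outflow_zero hα.2.1 hA hW r x)

/-- Hence **a non-trivial admissible DSS wave on `E₂(R)` forces `fluxConst α ≥ R⁻¹`**.
[cite: Tao2016AveragedNS, §4 (4.1), (4.3), Lemma 4.1 (4.8); cell vocabulary (`fluxConst`, `IsDSSWave`)] -/
theorem fluxConst_ge_of_dssWave_nontrivial {ε₀ R : ℝ}
    {α : Fin m → Fin m → Fin m → ℤ × ℤ × ℤ → ℝ} (hα : InTableClass R α)
    {ρ : Type*} [Fintype ρ] {π : Equiv.Perm ρ} {T : ℝ} {Φ : ρ → ℝ → Em m}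
    (hW : IsDSSWave ε₀ α π T Φ) (hnt : ∃ r x, Φ r x ≠ 0) :
    R⁻¹ ≤ fluxConst α := by
  obtain ⟨i₁, i₂, i, h⟩ := exists_outflow_ge_of_dssWave_nontrivial hα hW hnt
  refine h.trans ?_
  unfold fluxConst
  refine le_trans ?_ (Finset.single_le_sum (f := fun i => ∑ i₁, ∑ i₂, |α i₁ i₂ i (0, 0, 1)|)
    (fun j _ => Finset.sum_nonneg fun _ _ => Finset.sum_nonneg fun _ _ => abs_nonneg _)
    (Finset.mem_univ i))
  refine le_trans ?_ (Finset.single_le_sum (f := fun i₁ => ∑ i₂, |α i₁ i₂ i (0, 0, 1)|)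
    (fun j _ => Finset.sum_nonneg fun _ _ => abs_nonneg _) (Finset.mem_univ i₁))
  exact Finset.single_le_sum (f := fun i₂ => |α i₁ i₂ i (0, 0, 1)|) (fun j _ => abs_nonneg _)
    (Finset.mem_univ i₂)

/-! ## By name: the crux on the outflow-free corner -/

/-- **K2(1) on the outflow-free corner of `E₂(R)`, by name and uniformly in `ε₀`.** For every `R`, every
`ε₀ > 0`, every `α ∈ E₂(R)` with all `(0,0,1)` structure constants zero and every datum, the implication
of `TaoLadderRungTwoBreak.BlowupRigidityOne` holds — vacuously, its hypothesis `NoGlobalCascade ε₀ α X₀`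
being refuted by `not_noGlobalCascade_of_outflow_zero` (and its conclusion being unattainable there,
`dssWave_trivial_of_outflow_zero`): the crux has content only on tables with `fluxConst α ≥ R⁻¹`.
[cite: Tao2016AveragedNS, §4 Thm. 4.2 (statement shape), §5 p. 25; cell vocabulary (K2(1))] -/
theorem blowupRigidityOne_on_outflow_zero (R ε₀ : ℝ) (hε : 0 < ε₀)
    (α : Fin 4 → Fin 4 → Fin 4 → ℤ × ℤ × ℤ → ℝ) (X₀ : Fin 4 → ℝ) (hα : InTableClass R α)
    (hA : ∀ i₁ i₂ i, α i₁ i₂ i ((0 : ℤ), (0 : ℤ), (1 : ℤ)) = 0)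
    (hNG : NoGlobalCascade ε₀ α X₀) :
    ∃ (q : ℕ) (π : Equiv.Perm (Fin q)) (T : ℝ) (Φ : Fin q → ℝ → Em 4),
      IsDSSWave ε₀ α π T Φ ∧ Surviving 1 ε₀ T ∧ ∃ r x, Φ r x ≠ 0 :=
  absurd hNG (not_noGlobalCascade_of_outflow_zero hε hα hA)

end BlowupRigidityOne

end Summit.NavierStokesRegularity.NavierStokesRegularity.Theorems

end
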